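import Summits.QuantumFields.YangMills.Theorems.BalabanUVNodesN12AtRecord13Prop1KnitThm1OfRecord
import Summits.QuantumFields.YangMills.Theorems.BalabanUVNodesN12Prop1OfGaugeLetterExplicitLocLocal

/-!
# BalabanUVNodes ∕ N12 — «12Q-CLASS» (LOCAL edition): N12's Proposition-1 row at the record ON THE CLASS ROAD — the gauge letter (σ)_N discharged by name at a FIXED, EXPLICIT tolerance
# read off the minimiser's class (dag-n12-w3's `exists_gaugeLetterLoc_atRecord_explicit`), the numerics of that tolerance DISPLAYED per instance

Cell `pub-ymgap` (HUMAN RULINGS D-0062 ∕ D-0149), seat `pub-ymgap-dag-n12-d` g19 (R134 N12 [B15] s2 = by-name knit at the record; edition 3 of the session); count-neutral helper of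
K1⁹ `stmt-QuantumFields-27364` (`--kind proof --supports … --as helper`).  THEOREMS ONLY (0 `def`, 0 `instance`, 0 `sorry`); composition BY NAME.

WHAT.  The SIBLING of «12Q¹⁵» (p648613, the ∀δ∃e road of record (a)) on the CLASS road opened by dag-n12-w3 g4's OFFER (cell bus 2026-08-28T17:12Z) and keyed by
the LOCAL edition `(viii)_local` `…N12Prop1OfGaugeLetterExplicitLocLocal.…_ofMinimiserFamily_ofGaugeLetterExplicitLocal_ofChartConstantsN_ofCoercive` (this seat, on the lane owner's word «O1 GO», of dag-n12-w5 g5's (viii) p654901 = (iii) p637386 with the localised gauge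
letter `hσN` DISCHARGED BY NAME from dag-n12-w3's LOCAL producer `N12GaugeLetterLocExplicitLocal.exists_gaugeLetterLoc_atRecord_explicit_local` (p658487; LOCATED-WJ repair: the member-shadow letter `hGmem` asked only within walk-distance `ℓ_k + m′·L^k` of `Ω₁(Z)`) — the (σ)_N letter of record whose plaquette inputs are read
off the (2.12) CLASS of the minimiser at scale 0, budgets chosen, no-wrap ∕ radius numerics folded — and the two near-flatness tolerances PINNED to its explicit value
`T i := max (ρn i) (((2ℓ_k+1+m′L^k)²∕4)·(εreg·η₀²) + m′·(6κ·Σ_{l<k} Lˡ) + m′·ρn i)`).  Per run `P` and instance `i` the Prop-1 side of this file therefore displays: the guard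
`eR` with (J0′) R-explicit read at it, the datum tolerance `ρn` (linear in the guard, `hρn`), the Schur size `Kb`, the chart constants `ρs Cμ Cρ C₂ Cτ` with the localised chart
body `hchartN` (a binder on this road, as in (iii)), the NUMERICS `hsmallT`∕`hsmT`∕`hγle` AT THE PINNED TOLERANCE (the honest price of the class road: «ε small» becomes «εreg·L^{2k}
below the instance thresholds», dag-n12-w3's SCALING caveat), the (σ)-side residue of the explicit producer — level guard `c hkc hc`, radius rows `hMrad hM₁`, the region geometry
(gN1) `hGN`, (gN2) `hN1` and the member-shadow letter `hGmem`, the class threshold rows `hεpos hα3 hα2 haN` —, the bookkeeping constants `cE cA cJ` with `hcE heRa hcA hcJ'`,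
the geometry `hZ1 hZblk hdiv` and the [15] letter `h15`.  NO gauge letter, NO forest, NO transporter, NO plaquette letter for `U₀` (all inside the producer, from the class).
Generated from the (viii) endpoint by the seat's full re-keyer (`lean/g19/mk_knit_full.py`): every endpoint letter becomes a per-run family (`∀ (P : B12.RunParams) (i : ι P)`,
typed binders), per-lattice scalars become `B12.RunParams → ℝ` (`γ₈ cJ bx cE cA`), `hfar` is fed from the box letter `hZ1` (`far_letter_of_box`), `h15T` from `h15`
(`thm1TorusClass_of_variationalThm1RegSepCoP7M`); then 12E's `b15Leaf_WOfRecord₁₃_liveRepin₁₃_of_massLive_of_hasResiduals`.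

HONEST FRAMING ∕ LOCATED.  Bookkeeping by name over landed modules; (J0′), the chart body (χ)_N, [15] Thm 1, the numerics, the geometry, K0b's residuals and N12's per-run rows below
the torus (live-mass, (1.100) pin, (1.80), (1.89)) stay LETTERS; the class-road tolerance is scale-0 ∕ cap-radius crude (dag-n12-w3 ∕ dag-n12-c exchange, cell bus 15:50Z) — `hsmT`
is inhabitable only for `εreg` far below the instance thresholds; a currency edition; nothing of Bałaban's asserted; N12 NOT discharged; K0⁷ ∕ K1⁹ NOT closed; counts unmoved;
one finite 𝕋⁴ programme at fixed `ε = L^{-K}` — R4 closes only the conditional rung `BalabanLadder.UV`; no summit statement is proved here and NOT the Yang–Mills mass gap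
(Clay); nothing continuum ∕ ℝ⁴ ∕ OS.

References: [Balaban1989LargeFieldI] CMP 122 (1989) 175–202; [Balaban1989LargeFieldII] CMP 122 (1989) 355–392; [Balaban1988Convergent] CMP 119 (1988) 243–285;
[Balaban1985Variational] CMP 102 (1985) 277–309 (locators in the theorem docstring).
-/

noncomputable section
open MeasureTheory Set Finset Metric Filter
open scoped Matrix.Norms.L2Operator BigOperators Matrix RealInnerProductSpace Real InnerProductSpace Topology

namespace Summit.QuantumFields.YangMills.BalabanUVNodes.N12AtRecord13Prop1KnitThm1GaugeExplicitLocalOfRecord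

open Literature.MathematicalPhysics.QuantumFieldTheory.Balaban1983to89
open Literature.MathematicalPhysics.QuantumFieldTheory.Balaban1983to89.T4Continuum (T4Family LStep Letter walk walkEnd netDisp holAt)
open Literature.MathematicalPhysics.QuantumFieldTheory.Balaban1983to89.DagBinding
open Literature.MathematicalPhysics.QuantumFieldTheory.Balaban1983to89.Node00
open FlowStep (prefixOf BetaLowerH BetaUpperH)
open B15Claim189Assembly (Setting189 new189 chiPP dom half)
open B15 (Prop1Printed Ineq180)
open B15.BasicStep (Claim189)
open B15.PrelimIntegrations (Ineq191 Ineq195)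
open B15Chi124DetSets (E124)
open B14DomainGeom (Pt)
open B8Eq17ClassAkV1 (plaqsOf)
open B14.Eq216Concrete (inputs)
open GaugeGroup (dist1)
open GaugeField (plaqHol gaugeAct)
open B15Claim189PrintedConditions (omegaOfChain)
open B15Claim189PinsOfHistory (N0OfRecord₁₃)
open B15Claim189LambdaPin (enlD)
open B15RPrime1100OfRep (rPrimeDataOfSel)
open Summit.QuantumFields.YangMills.BalabanUVNodes.N12AtRecord13OfResiduals (b15Leaf_WOfRecord₁₃_liveRepin₁₃_of_massLive_of_hasResiduals)
open Summit.QuantumFields.YangMills.BalabanUVNodes.N12AtRecord13Prop1KnitThm1OfRecord (thm1TorusClass_of_variationalThm1RegSepCoP7M)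
open T4CubeChartGnomonic (SU2)
open B15Prop1ChartSU2 (su2Chart)
open B15Prop1SliceCoordinates (GaugeSlice ιA)
open T4AxialGaugeSmallField (castSite boxPlaqs boxBonds)
open B6BondElimination (unitVec)
open B6TreeGaugePoincare (curl)
open B16Eq18Proof (box)
open B15Extension193 (extend)
open B15ShellGauge193 (shellGauge)
open B15Sect1Instances (fun177std)
open B14.Eq213DetSet (Bj maxDomT)
open B14.Eq213MaximalDomains (side)
open B14.Eq22Determines (blockIter IsBlockUnion)
open Literature.MathematicalPhysics.QuantumFieldTheory.BalabanImbrieJaffe1984to88.BIJ85Eq453GaugeField (qsstarGIter0)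
open B16Sect1Backgrounds (expMul toMS)
open B15DeterminingSets (pts DetBackground genSet IsMinimizer MSField avgFamily bondsOf DetSet embIter)
open B5Eq118OneStroke (iterBlockOf)
open ExpMeanLog (deltaSU)
open B15Prop1Carrier (lfVarOn InstOn InstOn.std plaqsInside)
open Summit.QuantumFields.YangMills.BalabanUVNodes.N12Prop1OfGaugeLetterExplicitLocLocal (exists_domain_prop1Printed_lfVarOn_std_su2_box_intrinsic_analytic_atZSeqCoPRecord_ofThm1TorusClass_ofMinimiserFamily_ofGaugeLetterExplicitLocal_ofChartConstantsN_ofCoercive)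
open T4AdjointCovarianceUnitary (lieSU)
open B15Prop1GradientFromNearValueAtCoPRecord (far_letter_of_box)
open B15Prop1AnalyticExtClause (cplxVec anExt)
open B15Prop1ChartCalculusSU2 (E3)

variable {F : T4Family}

/-! ## §1 `N = 2`, generic `Θ` carrying node00-def-K0b's residuals: N12's Prop-1 row keyed on the CLASS-road endpoint (viii) (explicit fixed tolerance; numerics displayed) -/

section Generic
variable (Θ : Stage13Params F 2) (lam : ResidW F 2)

/-- **★★★★ N12's ROW BELOW THE TORUS AT THE LIVE RE-PIN, `N = 2`, AT PRINT's (1.74) OBJECT, PROP. 1 ON THE CLASS ROAD (gauge letter discharged at an explicit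
fixed tolerance)** — the knit re-keyed on the LOCAL edition `(viii)_local` `…N12Prop1OfGaugeLetterExplicitLocLocal.…_ofMinimiserFamily_ofGaugeLetterExplicitLocal_ofChartConstantsN_ofCoercive` (dag-n12-w3's LOCAL producer p658487 inside; LOCATED-WJ)
((iii) with `hσN` from dag-n12-w3's `exists_gaugeLetterLoc_atRecord_explicit` and `δc = δin := T i` pinned): per run `P` and instance family `ι P` the Prop-1 side displays the
guard `eR` + (J0′) at it, `ρn`+`hρn`, `Kb`, the chart constants + `hchartN`, the numerics `hsmallT hsmT hγle` at the pinned tolerance, the explicit producer's residue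
(`c hkc hc hMrad hM₁`, `hGN hN1 hGmem`, `hεpos hα3 hα2 haN`), `cE cA cJ` + `hcE heRa hcA hcJ'`, the geometry and the [15] letter `h15`.  The conclusion PRODUCES the
thresholds `areg P i` (LF radius read at `γ₈ P`); then 12E's `b15Leaf_WOfRecord₁₃_liveRepin₁₃_of_massLive_of_hasResiduals`.  WHAT STAYS A LETTER: everything displayed;
K0b's residuals `hres`; N12's per-run displays below the torus.  Count-neutral; NOT a discharge of N12. [cite: Balaban1989LargeFieldI, (0.2)–(0.6) p.176, (1.74) p.192, p.193 ll.14–20, Prop. 1 (1.77)–(1.78) p.194 («for ε > 0 sufficiently small»), (1.79)–(1.80) p.195, (1.89) p.198, (1.99)–(1.102) pp.200–201; Balaban1989LargeFieldII, p.357, (1.7)–(1.13) pp.358–359, (1.17)–(1.19) pp.360–361; Balaban1988Convergent, (2.1) p.254, (2.12)–(2.14) pp.256–257, (2.18) p.257, (3.16) p.268, (3.22)–(3.25) pp.269–270; Balaban1985Variational, (3)–(4) p.278, Thm 1 (8) p.279, (16)–(18) p.280, Prop. 9 (190) p.309 (bookkeeping)] -/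
theorem exists_areg_pinLF_b15Leaf_WOfRecord₁₃_liveRepin₁₃_of_massLive_of_hasResiduals_of_variationalThm1RegSepCoP7M_atZSeqCoPRecord_gaugeExplicitLocal (hres : Θ.HasResidualsOfRecord F 2)
    -- N12's displays at the letters `kSel ∕ D189 ∕ D1100` of `λ`, run by run, BELOW THE TORUS
    (hpin : ∀ P : B12.RunParams, lam.kSel P < P.K → lam.D1100 P
      = rPrimeDataOfSel (reprTOfRecord₁₃ F 2 (Θ.liveRepin₁₃ F 2) P (lam.kSel P))
          ((Θ.liveRepin₁₃ F 2).ppSel P (gOfRecord₁₃ F 2 (Θ.liveRepin₁₃ F 2) P) (lam.kSel P + 1))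
          (fibOfSeq F (Θ.liveRepin₁₃ F 2).ν (Θ.liveRepin₁₃ F 2).τ9 P (gOfRecord₁₃ F 2 (Θ.liveRepin₁₃ F 2) P) (lam.kSel P + 1)))
    (hmassLive : ∀ P : B12.RunParams, lam.kSel P < P.K → ∀ s, LiveSeq F 2 Θ.ν Θ.τ9 P (gOfRecord₁₃ F 2 (Θ.liveRepin₁₃ F 2) P) (lam.kSel P + 1)
        (slotsTOfRecord F 2 Θ.ν Θ.τ9 (EOfRecord₁₃ F 2 (Θ.liveRepin₁₃ F 2)) (wOfRecord₉ F 2 (Θ.liveRepin₁₃ F 2).toStage9Params)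
          (Θ.liveRepin₁₃ F 2).ppSel P (gOfRecord₁₃ F 2 (Θ.liveRepin₁₃ F 2) P) (lam.kSel P + 1)) s →
      0 < ∫ V, rterm (reprTOfRecord₁₃ F 2 (Θ.liveRepin₁₃ F 2) P (lam.kSel P)) s V ∂(fieldMeasure (F.P P.K) (lam.kSel P + 1) (SU 2)))
    (h180 : ∀ P : B12.RunParams, lam.kSel P < P.K → ∀ U, new189 (lam.D189 P) U → ∀ i, (lam.D189 P).h ≤ i → i ≤ (lam.D189 P).k →
      ∀ q ∈ plaqsOf (dom (lam.D189 P) i),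
        Ineq180 ((lam.D189 P).dev0 U q) ((lam.D189 P).ε (lam.D189 P).k) (lam.D189 P).η (lam.D189 P).B₃ (lam.D189 P).B₅ (lam.D189 P).M (lam.D189 P).δ
          ((lam.D189 P).dist q) (lam.D189 P).O1)
    (h189 : ∀ P : B12.RunParams, lam.kSel P < P.K → Claim189 (new189 (lam.D189 P)) (chiPP (lam.D189 P)))
    -- dag-n12-w5's endpoint `N12Prop1OfGaugeLetterExplicitLocLocal` ON THE RUN's LATTICE, per run `P` and instance family `ι P` (every letter of the endpoint displayed per run;
    -- `hfar` from the knit's box letter `hZ1` by `far_letter_of_box`, the [15] torus-class letter from `h15` by `thm1TorusClass_of_variationalThm1RegSepCoP7M`)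
    (hd3 : ∀ P : B12.RunParams, 3 ≤ (F.P P.K).d) (h0 : ∀ P : B12.RunParams, 0 < (F.P P.K).d) (ι : B12.RunParams → Type)
    {B₃ a₀ a₁' : ℝ}
    (Z Λ : ∀ P : B12.RunParams, ι P → Set (Site (F.P P.K) 0)) (k : ∀ P : B12.RunParams, ι P → ℕ) (M : ∀ P : B12.RunParams, ι P → ℝ) (hk0 : ∀ (P : B12.RunParams) (i : ι P), 0 < k P i) (hk : ∀ (P : B12.RunParams) (i : ι P), k P i ≤ (F.P P.K).m + (F.P P.K).K)
    (eR : ∀ P : B12.RunParams, ι P → ℝ) (heR : ∀ (P : B12.RunParams) (i : ι P), 0 < eR P i)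
    (T : ∀ (P : B12.RunParams) (i : ι P), Finset (PBond (F.P P.K) (k P i)))
    (lo hi : ∀ P : B12.RunParams, ι P → Fin (F.P P.K).d → ℤ) (n : ∀ P : B12.RunParams, ι P → ℕ) (hn : ∀ (P : B12.RunParams) (i : ι P) κ, hi P i κ ≤ lo P i κ + n P i) (hN : ∀ (P : B12.RunParams) (i : ι P), n P i + 2 < (F.P P.K).sitesPerDir (k P i))
    (hbox : ∀ (P : B12.RunParams) (i : ι P), pts (k P i) (Λ P i) = (castSite '' Set.Icc (lo P i) (hi P i) : Set (Site (F.P P.K) (k P i))))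
    (hZ : ∀ (P : B12.RunParams) (i : ι P), (boxPlaqs (lo P i - 1) (hi P i + 1) : Set (Plaq (F.P P.K) (k P i))) ⊆ plaqsInside (pts (k P i) (Z P i)))
    (hTG0 : ∀ (P : B12.RunParams) (i : ι P), T P i = (box (fun κ => (hi P i κ - lo P i κ + 1).toNat) (lo P i)).image fun x =>
      (⟨castSite (x - unitVec ⟨0, h0 P⟩), ⟨0, h0 P⟩⟩ : PBond (F.P P.K) (k P i)))
    (hN5 : ∀ (P : B12.RunParams) (i : ι P) κ, ((hi P i κ - lo P i κ + 1).toNat : ℤ) + 5 < (F.P P.K).sitesPerDir (k P i))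
    (Kb : ∀ P : B12.RunParams, ι P → ℕ) (hK1 : ∀ (P : B12.RunParams) (i : ι P), 1 ≤ Kb P i) (hKn : ∀ (P : B12.RunParams) (i : ι P) κ, (hi P i κ - lo P i κ + 1).toNat ≤ Kb P i)
    (ext : ∀ (P : B12.RunParams) (i : ι P), GaugeField (F.P P.K) (k P i) SU2 → GaugeField (F.P P.K) (k P i) SU2)
    (hext : ∀ (P : B12.RunParams) (i : ι P) Vk, ext P i Vk = extend (pts (k P i) (Λ P i)) (shellGauge Vk (lo P i) (hi P i)) Vk)
    (hlohi : ∀ (P : B12.RunParams) (i : ι P), lo P i ≤ hi P i)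
    -- the REGION parallelepipeds of the normalisation and the datum tolerances
    (LO HI : ∀ P : B12.RunParams, ι P → Fin (F.P P.K).d → ℤ) (hLO : ∀ (P : B12.RunParams) (i : ι P), LO P i ≤ lo P i - 1) (hHI : ∀ (P : B12.RunParams) (i : ι P), hi P i + 1 ≤ HI P i) (n' : ∀ P : B12.RunParams, ι P → ℕ) (hn' : ∀ (P : B12.RunParams) (i : ι P) κ, HI P i κ ≤ LO P i κ + n' P i)
    (hn'N : ∀ (P : B12.RunParams) (i : ι P), n' P i < (F.P P.K).sitesPerDir (k P i)) (hR' : ∀ (P : B12.RunParams) (i : ι P), (boxPlaqs (LO P i) (HI P i) : Set (Plaq (F.P P.K) (k P i))) ⊆ plaqsInside (pts (k P i) (Z P i)))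
    (ρn : ∀ P : B12.RunParams, ι P → ℝ)
    (hρn : ∀ (P : B12.RunParams) (i : ι P), (((F.P P.K).d : ℝ) * n' P i + 1) * ((((F.P P.K).d - 1 : ℕ) : ℝ) * n' P i * ((12 * (F.P P.K).d * (n P i + 2) ^ 2 + 1) * eR P i)
      + 3 * (F.P P.K).d * (n P i + 2) ^ 2 * eR P i) ≤ ρn P i)
    {γ₈ cJ bx : B12.RunParams → ℝ} (hγ : ∀ P : B12.RunParams, 0 < γ₈ P) (hcJ : ∀ P : B12.RunParams, 0 ≤ cJ P) (hbx : ∀ P : B12.RunParams, 0 ≤ bx P)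
    (hbxM : ∀ (P : B12.RunParams) (i : ι P), 12 * ((F.P P.K).d : ℝ) * ((n P i : ℝ) + 2) ^ 2 ≤ bx P * (M P i) ^ 2)
    {R 𝓐₀ : ∀ P : B12.RunParams, ι P → ℝ} (hM : ∀ (P : B12.RunParams) (i : ι P), 1 ≤ (M P i)) (hR : ∀ (P : B12.RunParams) (i : ι P), 0 < R P i)
    -- (J0′), R-EXPLICIT: per instance one radius and one bound for every base field of the strict guard
    (hMin : ∀ (P : B12.RunParams) (i : ι P) Vk, PlaqSmallOn (plaqsInside (pts (k P i) (Z P i ∩ (Λ P i)ᶜ))) (eR P i) Vk →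
      ∃ Ũ : VecField (F.P P.K) (k P i) (EuclideanSpace ℂ (Fin 3)) × VecField (F.P P.K) (k P i) (EuclideanSpace ℂ (Fin 3)) →
          PBond (F.P P.K) 0 → Matrix (Fin 2) (Fin 2) ℂ,
        (∀ b a c, DifferentiableOn ℂ (fun z => Ũ z b a c) (ball 0 (R P i))) ∧
        (∀ z ∈ ball (0 : VecField (F.P P.K) (k P i) (EuclideanSpace ℂ (Fin 3)) × VecField (F.P P.K) (k P i) (EuclideanSpace ℂ (Fin 3))) (R P i),
          ∀ b a c, ‖Ũ z b a c‖ ≤ 𝓐₀ P i) ∧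
        ∀ p B' : VecField (F.P P.K) (k P i) E3, ‖p‖ < R P i → ‖B'‖ < R P i → ∃ U' : GaugeField (F.P P.K) 0 SU2,
          (∀ b, Ũ (cplxVec p, cplxVec B') b = ((U' b : SU2) : Matrix (Fin 2) (Fin 2) ℂ)) ∧
            IsMinimizer (Node00.avOfRecord F 2 P.K) (Node00.regMSCoPOfRecord F 2 Θ.ν P.K (k P i) (maxDomT Θ.ν.M₁ (Z P i))) (Bj Θ.ν.M₁ (Z P i) (k P i))
              (avgFamily (Node00.avOfRecord F 2 P.K) (qsstarGIter0 (k P i) (expMul su2Chart B' (ext P i (expMul su2Chart p Vk))))) U')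
    -- the CHART CONSTANTS of dag-n12-w4's `chartLetter_of_letters_N` (binders, so that `hsm` can be stated); the tolerances are PINNED to the explicit producer's `T i` (docstring)
    (ρs Cμ Cρ C₂ Cτ : ∀ P : B12.RunParams, ι P → ℝ) (hCμ : ∀ (P : B12.RunParams) (i : ι P), 0 ≤ Cμ P i) (hCρ : ∀ (P : B12.RunParams) (i : ι P), 0 ≤ Cρ P i) (hC₂ : ∀ (P : B12.RunParams) (i : ι P), 0 ≤ C₂ P i)
    (hsmallT : ∀ (P : B12.RunParams) (i : ι P), max (ρn P i) ((((2 * (∑ l ∈ Finset.range (k P i + 1), ((F.P P.K).d * (((F.P P.K).L ^ l - 1) / 2) + 1)) + 1 + (3 * ((F.P P.K).d * (((F.P P.K).L - 1) / 2)) + 5) * (F.P P.K).L ^ (k P i) : ℕ) : ℝ)) ^ 2 / 4 * (Θ.ν.εreg * (F.P P.K).eta 0 ^ 2) + ((3 * ((F.P P.K).d * (((F.P P.K).L - 1) / 2)) + 5 : ℕ) : ℝ) * (6 * ((((((F.P P.K).d + 2) * (F.P P.K).L : ℕ) : ℝ) ^ 2 / 4) * (2 * (Θ.ν.εreg * (F.P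 P.K).L ^ 2))) * ∑ l ∈ Finset.range (k P i), ((F.P P.K).L : ℝ) ^ l) + ((3 * ((F.P P.K).d * (((F.P P.K).L - 1) / 2)) + 5 : ℕ) : ℝ) * ρn P i) ≤ ρs P i) (h𝓐₀ : ∀ (P : B12.RunParams) (i : ι P), 0 ≤ 𝓐₀ P i)
    -- LOCATED-CIN (R-a): per instance the bond neighbourhood on which the `inputs` near-flatness is delivered ∕ asked
    (N : ∀ P : B12.RunParams, ι P → Set (PBond (F.P P.K) 0))
    -- (σ)_N DISCHARGED BY NAME from dag-n12-w3 g4's `N12GaugeLetterLocExplicit.exists_gaugeLetterLoc_atRecord_explicit` (CLASS road, fixed tolerance): its displayed inputs —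
    -- NUMERICS (level guard ∕ no wrapping ∕ radii ∕ the class threshold `εreg`) and GEOMETRY ((gN1) `hGN` at the region box, (gN2) `hN1`, the member-shadow letter `hGmem`)
    (c : ∀ P : B12.RunParams, ι P → ℕ) (hkc : ∀ (P : B12.RunParams) (i : ι P), k P i + c P i ≤ (F.P P.K).m + (F.P P.K).K) (hc : ∀ (P : B12.RunParams) (i : ι P), 4 * (F.P P.K).d + (3 * ((F.P P.K).d * (((F.P P.K).L - 1) / 2)) + 5) + 3 < 2 * (F.P P.K).L ^ (c P i))
    (hMrad : ∀ P : B12.RunParams, (4 * (F.P P.K).d + (3 * ((F.P P.K).d * (((F.P P.K).L - 1) / 2)) + 5)) * (F.P P.K).L ^ 2 + 2 * (F.P P.K).d * (F.P P.K).L + 12 ≤ Θ.ν.M₁)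
    (hGN : ∀ (P : B12.RunParams) (i : ι P), ∀ b ∈ N P i, (b.src ∉ maxDomT Θ.ν.M₁ (Z P i) 1 ∨ b.tgt ∉ maxDomT Θ.ν.M₁ (Z P i) 1) → B14.Eq22Determines.blockIter (k P i) b.tgt ≠ B14.Eq22Determines.blockIter (k P i) b.src →
      (⟨B14.Eq22Determines.blockIter (k P i) b.src, b.dir⟩ : PBond (F.P P.K) (k P i)) ∈ (boxBonds (LO P i) (HI P i) : Set (PBond (F.P P.K) (k P i))))
    (hN1 : ∀ (P : B12.RunParams) (i : ι P), ∀ p : Plaq (F.P P.K) 0, ((⟨p.src, p.μ⟩ : PBond (F.P P.K) 0) ∈ {b : PBond (F.P P.K) 0 | b.src ∈ maxDomT Θ.ν.M₁ (Z P i) 1} ∨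
        (⟨p.src.shift p.μ, p.ν⟩ : PBond (F.P P.K) 0) ∈ {b : PBond (F.P P.K) 0 | b.src ∈ maxDomT Θ.ν.M₁ (Z P i) 1} ∨
        (⟨p.src.shift p.ν, p.μ⟩ : PBond (F.P P.K) 0) ∈ {b : PBond (F.P P.K) 0 | b.src ∈ maxDomT Θ.ν.M₁ (Z P i) 1} ∨
        (⟨p.src, p.ν⟩ : PBond (F.P P.K) 0) ∈ {b : PBond (F.P P.K) 0 | b.src ∈ maxDomT Θ.ν.M₁ (Z P i) 1}) →
      (⟨p.src, p.μ⟩ : PBond (F.P P.K) 0) ∈ N P i ∧ (⟨p.src.shift p.μ, p.ν⟩ : PBond (F.P P.K) 0) ∈ N P i ∧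
        (⟨p.src.shift p.ν, p.μ⟩ : PBond (F.P P.K) 0) ∈ N P i ∧ (⟨p.src, p.ν⟩ : PBond (F.P P.K) 0) ∈ N P i)
    (hεpos : 0 < Θ.ν.εreg)
    (hα3 : ∀ P : B12.RunParams, (143 * (((((F.P P.K).d + 4 : ℕ) : ℝ)) ^ 2 / 4) ^ 2) * (Θ.ν.εreg * (F.P P.K).L ^ 2) ≤ 1 / 3)
    (hα2 : ∀ P : B12.RunParams, 2 * (Θ.ν.εreg * (F.P P.K).L ^ 2) ≤ 2 * deltaSU (Fin 2) / ((((F.P P.K).d + 4) * (F.P P.K).L : ℕ) : ℝ) ^ 2)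
    (haN : ∀ P : B12.RunParams, (((((F.P P.K).d + 2) * (F.P P.K).L : ℕ) : ℝ) ^ 2 / 4) * (2 * (Θ.ν.εreg * (F.P P.K).L ^ 2)) < deltaSU (Fin 2))
    (hM₁ : ∀ P : B12.RunParams, (((F.P P.K).d + 4) * (F.P P.K).L + 6) * (F.P P.K).L ^ 2 ≤ Θ.ν.M₁)
    -- LOCATED-WJ (lane ruling 2026-08-28T17:49Z): the member-shadow letter asked ONLY for members within walk-distance `ℓ_{k} + m′·L^{k}` of `Ω₁(Z_i)` (dag-n12-w3's LOCAL producer)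
    (hGmem : ∀ (P : B12.RunParams) (i : ι P), ∀ x ∈ maxDomT Θ.ν.M₁ (Z P i) 1, ∀ lv ≤ k P i, ∀ c' ∈ bondsOf ((Bj Θ.ν.M₁ (Z P i) (k P i) : DetSet (F.P P.K)) lv),
      (∃ w : List (Letter (F.P P.K).d), w.length ≤ (∑ l ∈ Finset.range (k P i + 1), ((F.P P.K).d * (((F.P P.K).L ^ l - 1) / 2) + 1)) + (3 * ((F.P P.K).d * (((F.P P.K).L - 1) / 2)) + 5) * (F.P P.K).L ^ (k P i) ∧
        (walkEnd x w = embIter lv c'.src ∨ walkEnd x w = embIter lv c'.tgt)) →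
      B14.Eq22Determines.blockIter (k P i) (embIter lv c'.tgt) ≠ B14.Eq22Determines.blockIter (k P i) (embIter lv c'.src) → (⟨B14.Eq22Determines.blockIter (k P i) (embIter lv c'.src), c'.dir⟩ : PBond (F.P P.K) (k P i)) ∈ (boxBonds (LO P i) (HI P i) : Set (PBond (F.P P.K) (k P i))))
    -- (χ)_N AT THE CHART CONSTANTS: the body of dag-n12-w4's `chartLetter_of_letters` after its `∃ ρs Cμ Cρ C₂ Cτ`, per instance, with its `inputs` PREMISE LOCALISED to
    -- `N i` — a BINDER until `chartLetter_of_letters_N` lands (then supplied by name + `choose`, as in p631882 §1)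
    (hchartN : ∀ (P : B12.RunParams) (i : ι P),
      ∀ (ext' : GaugeField (F.P P.K) (k P i) SU2 → GaugeField (F.P P.K) (k P i) SU2) (Vk : GaugeField (F.P P.K) (k P i) SU2) {R' A' : ℝ}, 0 < R' → 0 ≤ A' →
      ∀ {δ' δi' : ℝ}, 0 ≤ δ' → 0 ≤ δi' → 0 < max δ' δi' → max δ' δi' ≤ ρs P i →
      ∀ (U₀ : GaugeField (F.P P.K) 0 SU2) (Xf : GaugeSlice (pts (k P i) (Λ P i)) (T P i) E3 → PBond (F.P P.K) 0 → lieSU (Fin 2)),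
      IsMinimizer (Node00.avOfRecord F 2 P.K) (Node00.regMSCoPOfRecord F 2 Θ.ν P.K (k P i) (maxDomT Θ.ν.M₁ (Z P i))) (Bj Θ.ν.M₁ (Z P i) (k P i))
        (avgFamily (Node00.avOfRecord F 2 P.K) (qsstarGIter0 (k P i) (ext' Vk))) U₀ →
      (∀ p : Plaq (F.P P.K) 0, ((⟨p.src, p.μ⟩ : PBond (F.P P.K) 0) ∈ {b : PBond (F.P P.K) 0 | b.src ∈ maxDomT Θ.ν.M₁ (Z P i) 1} ∨
          (⟨p.src.shift p.μ, p.ν⟩ : PBond (F.P P.K) 0) ∈ {b : PBond (F.P P.K) 0 | b.src ∈ maxDomT Θ.ν.M₁ (Z P i) 1} ∨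
          (⟨p.src.shift p.ν, p.μ⟩ : PBond (F.P P.K) 0) ∈ {b : PBond (F.P P.K) 0 | b.src ∈ maxDomT Θ.ν.M₁ (Z P i) 1} ∨
          (⟨p.src, p.ν⟩ : PBond (F.P P.K) 0) ∈ {b : PBond (F.P P.K) 0 | b.src ∈ maxDomT Θ.ν.M₁ (Z P i) 1}) →
        ‖((U₀ ⟨p.src, p.μ⟩ : SU2) : Matrix (Fin 2) (Fin 2) ℂ) - 1‖ ≤ δ' ∧ ‖((U₀ ⟨p.src.shift p.μ, p.ν⟩ : SU2) : Matrix (Fin 2) (Fin 2) ℂ) - 1‖ ≤ δ' ∧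
          ‖((U₀ ⟨p.src.shift p.ν, p.μ⟩ : SU2) : Matrix (Fin 2) (Fin 2) ℂ) - 1‖ ≤ δ' ∧ ‖((U₀ ⟨p.src, p.ν⟩ : SU2) : Matrix (Fin 2) (Fin 2) ℂ) - 1‖ ≤ δ') →
      (∀ b ∈ inputs (Bj Θ.ν.M₁ (Z P i) (k P i)), b ∈ N P i → ‖((U₀ b : SU2) : Matrix (Fin 2) (Fin 2) ℂ) - 1‖ ≤ δi') →
      Xf 0 = 0 → ContDiffAt ℝ 2 Xf 0 →
      (∀ᶠ Y in 𝓝 (0 : GaugeSlice (pts (k P i) (Λ P i)) (T P i) E3),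
        IsMinimizer (Node00.avOfRecord F 2 P.K) (Node00.regMSCoPOfRecord F 2 Θ.ν P.K (k P i) (maxDomT Θ.ν.M₁ (Z P i))) (Bj Θ.ν.M₁ (Z P i) (k P i))
          (avgFamily (Node00.avOfRecord F 2 P.K) (qsstarGIter0 (k P i) (expMul su2Chart (ιA (pts (k P i) (Λ P i)) (T P i) Y) (ext' Vk)))) (expChart U₀ (Xf Y))) →
      (∀ (X : GaugeSlice (pts (k P i) (Λ P i)) (T P i) E3) (b : PBond (F.P P.K) 0),
        ‖((fderiv ℝ Xf 0 X b : lieSU (Fin 2)) : Matrix (Fin 2) (Fin 2) ℂ)‖ ≤ 8 * A' / R' * ‖X‖ ∧ ‖fderiv ℝ Xf 0 X b‖ ≤ 12 * A' / R' * ‖X‖) →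
      (∀ (X : GaugeSlice (pts (k P i) (Λ P i)) (T P i) E3) (b : PBond (F.P P.K) 0), b.src ∉ maxDomT Θ.ν.M₁ (Z P i) 1 → fderiv ℝ Xf 0 X b = 0) →
      ∃ (Ψ₂ : (PBond (F.P P.K) 0 → lieSU (Fin 2)) →L[ℝ] (PBond (F.P P.K) 0 → lieSU (Fin 2)) →L[ℝ] (Fin (constrCard (Bj Θ.ν.M₁ (Z P i) (k P i)) (k P i)) → lieSU (Fin 2)))
        (lam : (Fin (constrCard (Bj Θ.ν.M₁ (Z P i) (k P i)) (k P i)) → lieSU (Fin 2)) →L[ℝ] ℝ)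
        (p : Seminorm ℝ (PBond (F.P P.K) 0 → lieSU (Fin 2))) (q : (Fin (constrCard (Bj Θ.ν.M₁ (Z P i) (k P i)) (k P i)) → lieSU (Fin 2)) → ℝ)
        (Lf : (PBond (F.P P.K) 0 → lieSU (Fin 2)) →L[ℝ] (Fin (constrCard (Bj Θ.ν.M₁ (Z P i) (k P i)) (k P i)) → lieSU (Fin 2)))
        (Rf : (Fin (constrCard (Bj Θ.ν.M₁ (Z P i) (k P i)) (k P i)) → lieSU (Fin 2)) → PBond (F.P P.K) 0 → lieSU (Fin 2)),
        HasFDerivAt (fun Y => fderiv ℝ (msChart F 2 P.K (k P i) (Bj Θ.ν.M₁ (Z P i) (k P i)) (avgFamily (Node00.avOfRecord F 2 P.K) (qsstarGIter0 (k P i) (ext' Vk))) U₀) Y) Ψ₂ 0 ∧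
        (∀ᶠ Y in 𝓝 (0 : PBond (F.P P.K) 0 → lieSU (Fin 2)),
          DifferentiableAt ℝ (msChart F 2 P.K (k P i) (Bj Θ.ν.M₁ (Z P i) (k P i)) (avgFamily (Node00.avOfRecord F 2 P.K) (qsstarGIter0 (k P i) (ext' Vk))) U₀) Y) ∧
        fderiv ℝ (fun Y : PBond (F.P P.K) 0 → lieSU (Fin 2) => wilsonAction4 (expChart U₀ Y)) 0 =
          lam.comp (fderiv ℝ (msChart F 2 P.K (k P i) (Bj Θ.ν.M₁ (Z P i) (k P i)) (avgFamily (Node00.avOfRecord F 2 P.K) (qsstarGIter0 (k P i) (ext' Vk))) U₀) 0) ∧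
        (∀ Y : PBond (F.P P.K) 0 → lieSU (Fin 2), ∑ b, ‖(Y b : Matrix (Fin 2) (Fin 2) ℂ)‖ ^ 2 ≤ p Y ^ 2) ∧
        (∀ v, Lf (Rf v) = v) ∧ (∀ v, p (Rf v) ≤ Cρ P i * q v) ∧
        ∀ X : GaugeSlice (pts (k P i) (Λ P i)) (T P i) E3,
          q (fderiv ℝ (msChart F 2 P.K (k P i) (Bj Θ.ν.M₁ (Z P i) (k P i)) (avgFamily (Node00.avOfRecord F 2 P.K) (qsstarGIter0 (k P i) (ext' Vk))) U₀) 0 (fderiv ℝ Xf 0 X)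
              - Lf (fderiv ℝ Xf 0 X)) ≤ (C₂ P i * max δ' δi') * p (fderiv ℝ Xf 0 X) ∧
          lam (Ψ₂ (fderiv ℝ Xf 0 X) (fderiv ℝ Xf 0 X)) ≤ (Cμ P i * max δ' δi') * p (fderiv ℝ Xf 0 X) ^ 2 ∧
          p (fderiv ℝ Xf 0 X) ≤ (12 * A' / R' * Real.sqrt (Nat.card {b : PBond (F.P P.K) 0 // b.src ∈ maxDomT Θ.ν.M₁ (Z P i) 1})) * ‖X‖ ∧
          ∃ m : ℝ, (∀ w', Lf w' = fderiv ℝ (msChart F 2 P.K (k P i) (Bj Θ.ν.M₁ (Z P i) (k P i)) (avgFamily (Node00.avOfRecord F 2 P.K) (qsstarGIter0 (k P i) (ext' Vk))) U₀) 0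
                (fderiv ℝ Xf 0 X) →
              m ≤ fderiv ℝ (fun Y => fderiv ℝ (fun Y : PBond (F.P P.K) 0 → lieSU (Fin 2) => wilsonAction4 (expChart (1 : GaugeField (F.P P.K) 0 SU2) Y)) Y) 0 w' w') ∧
            (((F.P P.K).L : ℝ) ^ (F.P P.K).d) ^ (k P i) / ((((F.P P.K).L : ℝ)) ^ 2 * ((F.P P.K).L : ℝ) ^ 2) ^ (k P i) *
                (∑ z ∈ box (fun κ => (hi P i κ - lo P i κ + 1).toNat + 3) (fun κ => lo P i κ - 2), ∑ μ : Fin (F.P P.K).d, ∑ a : Fin 3,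
                  curl (fun b => ιA (pts (k P i) (Λ P i)) (T P i) X (⟨castSite b.1, b.2⟩ : PBond (F.P P.K) (k P i)) a) z ⟨0, h0 P⟩ μ ^ 2)
              - ((((F.P P.K).L : ℝ) ^ (F.P P.K).d) ^ (k P i) / ((((F.P P.K).L : ℝ)) ^ 2 * ((F.P P.K).L : ℝ) ^ 2) ^ (k P i)
                  * (16 * (((F.P P.K).d : ℝ) + 1) * (Cτ P i * max δ' δi'))) * ‖X‖ ^ 2 ≤ m)
    -- numerics IN THE CHART CONSTANTS AT THE PINNED TOLERANCE `T i` (`γ₀ := 1`: dag-n12-w4's per-instance `γ₀(k) = (L^d)^k∕(L²·L²)^k` is `1` at `d = 4`): the assembled `Cerr i` is small, the positivity constant fits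
    (hsmT : ∀ (P : B12.RunParams) (i : ι P), (32 * (((F.P P.K).d : ℝ) - 1) * (max (ρn P i) ((((2 * (∑ l ∈ Finset.range (k P i + 1), ((F.P P.K).d * (((F.P P.K).L ^ l - 1) / 2) + 1)) + 1 + (3 * ((F.P P.K).d * (((F.P P.K).L - 1) / 2)) + 5) * (F.P P.K).L ^ (k P i) : ℕ) : ℝ)) ^ 2 / 4 * (Θ.ν.εreg * (F.P P.K).eta 0 ^ 2) + ((3 * ((F.P P.K).d * (((F.P P.K).L - 1) / 2)) + 5 : ℕ) : ℝ) * (6 * ((((((F.P P.K).d + 2) * (F.P P.K).L : ℕ) : ℝ) ^ 2 / 4) * (2 * (Θ.ν.εreg * (F.P P.K).L ^ 2))) * ∑ l ∈ Finset.range (k P i), ((F.P P.K).L : ℝ) ^ l) + ((3 * ((F.P P.K).d * (((F.P P.K).L - 1) / 2)) + 5 : ℕ) : ℝ) * ρn P i)) + Cμ P i * max ((max (ρn P i) ((((2 * (∑ l ∈ Finset.range (k P i + 1), ((F.P P.K).d * (((F.P P.K).L ^ l - 1) / 2) + 1)) + 1 + (3 * ((F.P P.K).d * (((F.P P.K).L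 - 1) / 2)) + 5) * (F.P P.K).L ^ (k P i) : ℕ) : ℝ)) ^ 2 / 4 * (Θ.ν.εreg * (F.P P.K).eta 0 ^ 2) + ((3 * ((F.P P.K).d * (((F.P P.K).L - 1) / 2)) + 5 : ℕ) : ℝ) * (6 * ((((((F.P P.K).d + 2) * (F.P P.K).L : ℕ) : ℝ) ^ 2 / 4) * (2 * (Θ.ν.εreg * (F.P P.K).L ^ 2))) * ∑ l ∈ Finset.range (k P i), ((F.P P.K).L : ℝ) ^ l) + ((3 * ((F.P P.K).d * (((F.P P.K).L - 1) / 2)) + 5 : ℕ) : ℝ) * ρn P i))) ((max (ρn P i) ((((2 * (∑ l ∈ Finset.range (k P i + 1), ((F.P P.K).d * (((F.P P.K).L ^ l - 1) / 2) + 1)) + 1 + (3 * ((F.P P.K).d * (((F.P P.K).L - 1) / 2)) + 5) * (F.P P.K).L ^ (k P i) : ℕ) : ℝ)) ^ 2 / 4 * (Θ.ν.εreg * (F.P P.K).eta 0 ^ 2) + ((3 * ((F.P P.K).d * (((F.P P.K).L - 1) / 2)) + 5 : ℕ) : ℝ) * (6 * ((((((F.P P.K).d + 2) * (F.P P.K).L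 : ℕ) : ℝ) ^ 2 / 4) * (2 * (Θ.ν.εreg * (F.P P.K).L ^ 2))) * ∑ l ∈ Finset.range (k P i), ((F.P P.K).L : ℝ) ^ l) + ((3 * ((F.P P.K).d * (((F.P P.K).L - 1) / 2)) + 5 : ℕ) : ℝ) * ρn P i)))
        + 16 * (((F.P P.K).d : ℝ) - 1) * (Cρ P i * (C₂ P i * max ((max (ρn P i) ((((2 * (∑ l ∈ Finset.range (k P i + 1), ((F.P P.K).d * (((F.P P.K).L ^ l - 1) / 2) + 1)) + 1 + (3 * ((F.P P.K).d * (((F.P P.K).L - 1) / 2)) + 5) * (F.P P.K).L ^ (k P i) : ℕ) : ℝ)) ^ 2 / 4 * (Θ.ν.εreg * (F.P P.K).eta 0 ^ 2) + ((3 * ((F.P P.K).d * (((F.P P.K).L - 1) / 2)) + 5 : ℕ) : ℝ) * (6 * ((((((F.P P.K).d + 2) * (F.P P.K).L : ℕ) : ℝ) ^ 2 / 4) * (2 * (Θ.ν.εreg * (F.P P.K).L ^ 2))) * ∑ l ∈ Finset.range (k P i), ((F.P P.K).L : ℝ) ^ l) + ((3 * ((F.P P.K).d * (((F.P P.K).L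 - 1) / 2)) + 5 : ℕ) : ℝ) * ρn P i))) ((max (ρn P i) ((((2 * (∑ l ∈ Finset.range (k P i + 1), ((F.P P.K).d * (((F.P P.K).L ^ l - 1) / 2) + 1)) + 1 + (3 * ((F.P P.K).d * (((F.P P.K).L - 1) / 2)) + 5) * (F.P P.K).L ^ (k P i) : ℕ) : ℝ)) ^ 2 / 4 * (Θ.ν.εreg * (F.P P.K).eta 0 ^ 2) + ((3 * ((F.P P.K).d * (((F.P P.K).L - 1) / 2)) + 5 : ℕ) : ℝ) * (6 * ((((((F.P P.K).d + 2) * (F.P P.K).L : ℕ) : ℝ) ^ 2 / 4) * (2 * (Θ.ν.εreg * (F.P P.K).L ^ 2))) * ∑ l ∈ Finset.range (k P i), ((F.P P.K).L : ℝ) ^ l) + ((3 * ((F.P P.K).d * (((F.P P.K).L - 1) / 2)) + 5 : ℕ) : ℝ) * ρn P i))))) * (2 + Cρ P i * (C₂ P i * max ((max (ρn P i) ((((2 * (∑ l ∈ Finset.range (k P i + 1), ((F.P P.K).d * (((F.P P.K).L ^ l - 1) / 2) + 1)) + 1 + (3 * ((F.P P.K).d * (((F.P P.K).L - 1) / 2))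 + 5) * (F.P P.K).L ^ (k P i) : ℕ) : ℝ)) ^ 2 / 4 * (Θ.ν.εreg * (F.P P.K).eta 0 ^ 2) + ((3 * ((F.P P.K).d * (((F.P P.K).L - 1) / 2)) + 5 : ℕ) : ℝ) * (6 * ((((((F.P P.K).d + 2) * (F.P P.K).L : ℕ) : ℝ) ^ 2 / 4) * (2 * (Θ.ν.εreg * (F.P P.K).L ^ 2))) * ∑ l ∈ Finset.range (k P i), ((F.P P.K).L : ℝ) ^ l) + ((3 * ((F.P P.K).d * (((F.P P.K).L - 1) / 2)) + 5 : ℕ) : ℝ) * ρn P i))) ((max (ρn P i) ((((2 * (∑ l ∈ Finset.range (k P i + 1), ((F.P P.K).d * (((F.P P.K).L ^ l - 1) / 2) + 1)) + 1 + (3 * ((F.P P.K).d * (((F.P P.K).L - 1) / 2)) + 5) * (F.P P.K).L ^ (k P i) : ℕ) : ℝ)) ^ 2 / 4 * (Θ.ν.εreg * (F.P P.K).eta 0 ^ 2) + ((3 * ((F.P P.K).d * (((F.P P.K).L - 1) / 2)) + 5 : ℕ) : ℝ) * (6 * ((((((F.P P.K).d + 2) * (F.P P.K).L : ℕ) : ℝ)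 ^ 2 / 4) * (2 * (Θ.ν.εreg * (F.P P.K).L ^ 2))) * ∑ l ∈ Finset.range (k P i), ((F.P P.K).L : ℝ) ^ l) + ((3 * ((F.P P.K).d * (((F.P P.K).L - 1) / 2)) + 5 : ℕ) : ℝ) * ρn P i))))))
        * (12 * 𝓐₀ P i / R P i * Real.sqrt (Nat.card {b : PBond (F.P P.K) 0 // b.src ∈ maxDomT Θ.ν.M₁ (Z P i) 1})) ^ 2
        + 16 * (((F.P P.K).d : ℝ) + 1) * (Cτ P i * max ((max (ρn P i) ((((2 * (∑ l ∈ Finset.range (k P i + 1), ((F.P P.K).d * (((F.P P.K).L ^ l - 1) / 2) + 1)) + 1 + (3 * ((F.P P.K).d * (((F.P P.K).L - 1) / 2)) + 5) * (F.P P.K).L ^ (k P i) : ℕ) : ℝ)) ^ 2 / 4 * (Θ.ν.εreg * (F.P P.K).eta 0 ^ 2) + ((3 * ((F.P P.K).d * (((F.P P.K).L - 1) / 2)) + 5 : ℕ) : ℝ) * (6 * ((((((F.P P.K).d + 2) * (F.P P.K).L : ℕ) : ℝ) ^ 2 / 4) * (2 * (Θ.ν.εreg * (F.P P.K).L ^ 2)))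 * ∑ l ∈ Finset.range (k P i), ((F.P P.K).L : ℝ) ^ l) + ((3 * ((F.P P.K).d * (((F.P P.K).L - 1) / 2)) + 5 : ℕ) : ℝ) * ρn P i))) ((max (ρn P i) ((((2 * (∑ l ∈ Finset.range (k P i + 1), ((F.P P.K).d * (((F.P P.K).L ^ l - 1) / 2) + 1)) + 1 + (3 * ((F.P P.K).d * (((F.P P.K).L - 1) / 2)) + 5) * (F.P P.K).L ^ (k P i) : ℕ) : ℝ)) ^ 2 / 4 * (Θ.ν.εreg * (F.P P.K).eta 0 ^ 2) + ((3 * ((F.P P.K).d * (((F.P P.K).L - 1) / 2)) + 5 : ℕ) : ℝ) * (6 * ((((((F.P P.K).d + 2) * (F.P P.K).L : ℕ) : ℝ) ^ 2 / 4) * (2 * (Θ.ν.εreg * (F.P P.K).L ^ 2))) * ∑ l ∈ Finset.range (k P i), ((F.P P.K).L : ℝ) ^ l) + ((3 * ((F.P P.K).d * (((F.P P.K).L - 1) / 2)) + 5 : ℕ) : ℝ) * ρn P i))))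
      ≤ 1 / (2 * (3 * (Kb P i : ℝ) ^ 2 + 2 * (Kb P i : ℝ) ^ 4)))
    (hγle : ∀ (P : B12.RunParams) (i : ι P), γ₈ P / (M P i) ^ 5 ≤ 1 / (2 * (3 * (Kb P i : ℝ) ^ 2 + 2 * (Kb P i : ℝ) ^ 4)))
    -- the geometric letter: every fine site whose k-block label lies in the box `[lo − 1, hi + 1]` lies in `Ω₁(Z)` (print: `Λ` deep inside `Z`); dag-n12-c's `far_letter_of_box` turns it into the bond letter `hfar`
    (hZ1 : ∀ (P : B12.RunParams) (i : ι P) (y : Site (F.P P.K) 0), B14.Eq22Determines.blockIter (k P i) y ∈ (castSite '' Set.Icc (lo P i - 1) (hi P i + 1) : Set (Site (F.P P.K) (k P i))) → y ∈ maxDomT Θ.ν.M₁ (Z P i) 1)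
    (hZblk : ∀ (P : B12.RunParams) (i : ι P), IsBlockUnion (k P i) (Z P i))
    (hdiv : ∀ (P : B12.RunParams) (i : ι P), side (F.P P.K).L Θ.ν.M₁ (k P i) ∣ (F.P P.K).sitesPerDir 0)
    {cE cA : B12.RunParams → ℝ} (hcE0 : ∀ P : B12.RunParams, 0 ≤ cE P) (hcE : ∀ (P : B12.RunParams) (i : ι P), 12 * ((F.P P.K).d : ℝ) * ((n P i : ℝ) + 2) ^ 2 ≤ cE P)
    (heRa : ∀ (P : B12.RunParams) (i : ι P), (cE P + 1) * eR P i ≤ a₁' ∧ B₃ * ((cE P + 1) * eR P i) ≤ Θ.ν.εreg)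
    (hcA : ∀ P : B12.RunParams, 1 / 2 * (B₃ * (cE P + 1) * (F.P P.K).eta 1 ^ 2) ^ 2 * (Fintype.card (Plaq (F.P P.K) 0) : ℝ) ≤ cA P)
    (hcJ' : ∀ (P : B12.RunParams) (i : ι P), 2 * cA P * eR P i / R P i + 4 * ((Fintype.card (Plaq (F.P P.K) 0) : ℝ) * (1 + 8 * 𝓐₀ P i ^ 4)) / (R P i * eR P i) ≤ cJ P)
    (hM2 : 2 ≤ Θ.ν.M₁) (hB₃ : 0 ≤ B₃) (ha₀ : Θ.ν.εreg ≤ a₀) (h15 : VariationalThm1RegSepCoP7M F 2 B₃ a₀ a₁') :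
    ∃ areg : ∀ P : B12.RunParams, ι P → ℝ, (∀ P i, 0 < areg P i) ∧
      ∀ P : B12.RunParams, lam.kSel P < P.K →
        B15Leaf (WOfRecord₁₃ F 2 (Θ.liveRepin₁₃ F 2)
          { lam with LF := fun P => lfVarOn su2Chart fun i => InstOn.std (Node00.bgMSCoPOfRecord F 2 Θ.ν P.K (k P i) (maxDomT Θ.ν.M₁ (Z P i))) Θ.ν.M₁ (Z P i) (Λ P i) (k P i) (M P i) (areg P i) (anExt (pts (k P i) (Λ P i)) (T P i) (fun177std (Node00.bgMSCoPOfRecord F 2 Θ.ν P.K (k P i) (maxDomT Θ.ν.M₁ (Z P i))) Θ.ν.M₁ (Z P i) (k P i)) (ext P i) (min (1 / 2) (min (R P i / 8) (γ₈ P / (M P i) ^ 5 * (R P i / 2) ^ 2 / (48 * (4 * ((Fintype.card (Plaq (F.P P.K) 0) : ℝ) * (1 + 8 * 𝓐₀ P i ^ 4)) / R P i + 1)))))) } P) := by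
  choose areg hapos hrow using fun P : B12.RunParams =>
    exists_domain_prop1Printed_lfVarOn_std_su2_box_intrinsic_analytic_atZSeqCoPRecord_ofThm1TorusClass_ofMinimiserFamily_ofGaugeLetterExplicitLocal_ofChartConstantsN_ofCoercive (F := F) Θ.ν P.K (hd3 P) (h0 P)
      (Z := Z P) (Λ := Λ P) (k := k P) (M := M P) (hk0 := hk0 P) (hk := hk P) (eR := eR P) (heR := heR P) (T := T P) (lo := lo P) (hi := hi P) (n := n P) (hn := hn P)
      (hN := hN P) (hbox := hbox P) (hZ := hZ P) (hTG0 := hTG0 P) (hN5 := hN5 P) (K := Kb P) (hK1 := hK1 P) (hKn := hKn P) (ext := ext P) (hext := hext P) (hlohi := hlohi P)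
      (LO := LO P) (HI := HI P) (hLO := hLO P) (hHI := hHI P) (n' := n' P) (hn' := hn' P) (hn'N := hn'N P) (hR' := hR' P) (ρn := ρn P) (hρn := hρn P) (hγ := hγ P)
      (hcJ := hcJ P) (hbx := hbx P) (hbxM := hbxM P) (hM := hM P) (hR := hR P) (hMin := hMin P) (ρs := ρs P) (Cμ := Cμ P) (Cρ := Cρ P) (C₂ := C₂ P) (Cτ := Cτ P)
      (hCμ := hCμ P) (hCρ := hCρ P) (hC₂ := hC₂ P) (hsmallT := hsmallT P) (h𝓐₀ := h𝓐₀ P) (N := N P) (c := c P) (hkc := hkc P) (hc := hc P) (hMrad := hMrad P)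
      (hGN := hGN P) (hN1 := hN1 P) (hεpos := hεpos) (hα3 := hα3 P) (hα2 := hα2 P) (haN := haN P) (hM₁ := hM₁ P) (hGmem := hGmem P) (hchartN := hchartN P) (hsmT := hsmT P)
      (hγle := hγle P) (hfar := fun i b hb => far_letter_of_box (hbox P i) (hZ1 P i) b hb) (hZblk := hZblk P) (hM2 := hM2) (hdiv := hdiv P) (hcE0 := hcE0 P)
      (hcE := hcE P) (hB₃ := hB₃) (heRa := heRa P) (ha₀ := ha₀) (hcA := hcA P) (h15T := thm1TorusClass_of_variationalThm1RegSepCoP7M Θ.ν P.K h15) (hcJ' := hcJ' P)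
  refine ⟨areg, hapos, fun P hkP => ?_⟩
  apply b15Leaf_WOfRecord₁₃_liveRepin₁₃_of_massLive_of_hasResiduals Θ _ hres (P := P)
  · exact hkP
  · exact hpin P hkP
  · exact hmassLive P hkP
  · exact hrow P
  · exact h180 P hkP
  · exact h189 P hkP

end Generic

end Summit.QuantumFields.YangMills.BalabanUVNodes.N12AtRecord13Prop1KnitThm1GaugeExplicitLocalOfRecord

end
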